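import Summits.NavierStokesRegularity.FunctionalMining.StretchingLaminateQuartic
import Mathlib.Analysis.Matrix.Spectrum
import Mathlib.LinearAlgebra.Matrix.Hermitian
import Mathlib.LinearAlgebra.Matrix.Notation
import Mathlib.Tactic.FinCases
import Mathlib.Tactic.FieldSimp
import Mathlib.Tactic.Linarith
import Mathlib.Tactic.Ring
import Mathlib.Tactic.NormNum
import Mathlib.Tactic.Positivity
import HarnessLib

/-!
# FunctionalMining — K1-Q1 laminates: the SPECTRAL BRIDGE `PolyClaim θ a b c → LeafClaim θ a b c → RatioBound θ` (dict seat, staged; bank g5's eigenframe blocks verbatim)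

search for candidate a priori estimates; no regularity claim.  Static real algebra (one use of Mathlib's spectral theorem for a real symmetric
`3 × 3` matrix) on top of the dict laminate chain; nothing about Navier–Stokes solutions; no literature claim.

This file closes the one gap left by `StretchingLaminateQuartic` (ap): there the dual assembly
`ratioBound_of_leafClaim : LeafClaim θ a b c → 0 ≤ c → RatioBound θ` takes the per-leaf dual inequality in
INVARIANT (matrix-entry) form, while the census seats kernel-certified bank's claim in the reduced variables
`(m, q, s) = (|ω|², |S|², top eigenvalue of S)` (census-1 A `StretchingLaminateCapClaim.lean`, census-2 B
`LaminateCapPolyT4.lean`, both Mathlib-only, 2026-08-20 09:06Z).  The bridge is the orthonormal eigenframe of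
`S = (G + Gᵀ)/2`:

* **Part G0 and Part A' below are VERBATIM from bank g5's kernel scratch** `pub-nsfunc-bank/LAMCAP-TREE.scratch.lean`
  v3 (2026-08-20T09:22:00Z, sha256[:16] 40389dbeb83c4053, `import Mathlib`, farm rc 0 / 0 sorry per bank; authorship bank g5), re-homed from
  namespace `LamCapScratch` to `Laminate`: `LeafDV` (eigenframe form, `M = 1`), **`PolyClaim θ a b c₄`** (census's
  `(m,q,s)` typing, binder-for-binder census-1's `Phi4 ≤ 0` / census-2's `phiT4 ≤ 0`), `leafDV_case`,
  **`leafDV_of_polyClaim`** (`ωᵀSω ≤ s₁|ω|²` termwise, `Σdᵢ³ = (3/2)s₁(2s₁² − q)`, `q ≤ 6s₁²`, `3s₁² ≤ 2q` from the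
  ordering of the eigenvalues), `leaf_hom_gen` (homogenisation `M > 0` by scaling, `M = 0` directly), and
  **`sym3_reduce`** (for a real symmetric `3 × 3` matrix and a vector: `∃ d v, Σdᵢ = tr S ∧ Σdᵢ² = |S|² ∧ Σdᵢ³ = tr S³ ∧
  Σvᵢ² = |w|² ∧ Σdᵢvᵢ² = wᵀSw`, by `Matrix.IsHermitian.spectral_theorem`).
* **dict's part**: `FrameClaim` (the homogeneous eigenframe form = `leaf_hom_gen`'s conclusion divided by `M`),
  `frameClaim_of_leafDV`, **`leafClaim_of_frameClaim : FrameClaim θ a b c → LeafClaim θ a b c`** (`sym3_reduce` at the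
  symmetric part of a rational `Grad` and its vorticity vector; the five invariants are `Grad.trace`, `Grad.sSq`,
  `Grad.symCubeTrace`, `Grad.vortSq`, `Grad.stretch` by `ring`), `leafClaim_of_polyClaim`,
  **`ratioBound_of_polyClaim : 0 ≤ 1 − 3b/4 → 0 ≤ c → PolyClaim θ a b c → RatioBound θ`**,
  `laminateSupConst_le_of_polyClaim`, and **`lcapLeafClaim_of_polyClaim : PolyClaim (269427/250000) (−562019/10⁶)
  (2007/15625) (55539/(4·10⁷)) → LCapLeafClaim`** — so a filed census claim theorem discharges the node of (ap) in three
  lines (`StretchingLaminateCapFinal`, (ar)), giving `laminateSupConst ≤ 1.077708` and the realization-free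
  `LaminateDeficit` as KERNEL theorems; bank's own `9/8` leaf inequality does the same census-independently
  (`StretchingLaminateNineEighths`, (as)).
Bank's scratch also contains a second, independent kernel proof of the whole tree theorem (`chord_T4` by an exact
3-point quadrature identity and ONE induction `dualFromG_le`); it is not duplicated here — the tree half used by this
chain is dict's (an)/(ao)/(ap) (martingale principle, Betchov, exact two-point certificate, quartic moment).
search for candidate a priori estimates; no regularity claim.
-/


namespace Summit.NavierStokesRegularity.FunctionalMining

namespace Laminate

/-! ## Part G0 — generic multipliers (θ, a, b, c₄): the per-leaf statement in eigenframe form and in census's (m,q,s) form -/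

/-- The per-leaf dual inequality in the strain eigenframe (M = 1), for general multipliers. -/
def LeafDV (θ a b c₄ : ℝ) : Prop :=
  ∀ d1 d2 d3 v1 v2 v3 : ℝ, d1 + d2 + d3 = 0 → v1 ^ 2 + v2 ^ 2 + v3 ^ 2 ≤ 1 →
    (1 - 3 / 4 * b) * (d1 * v1 ^ 2 + d2 * v2 ^ 2 + d3 * v3 ^ 2) - θ * (d1 ^ 2 + d2 ^ 2 + d3 ^ 2)
      - a * ((d1 ^ 2 + d2 ^ 2 + d3 ^ 2) - (v1 ^ 2 + v2 ^ 2 + v3 ^ 2) / 2) - b * (d1 ^ 3 + d2 ^ 3 + d3 ^ 3)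
      - c₄ * ((d1 ^ 2 + d2 ^ 2 + d3 ^ 2) ^ 2 + (6 * (d1 ^ 2 + d2 ^ 2 + d3 ^ 2) + 24) * (1 - (v1 ^ 2 + v2 ^ 2 + v3 ^ 2))
        - 24) ≤ 0

/-- The bank's POLYNOMIAL CLAIM of K1Q1-LAMINATE-CAP §3 in census-1's typing (m = |ω|², q = |S|², s = top strain eigenvalue,
`ωᵀSω ≤ m s`, `tr S³ = (3/2) s (2s² − q)`, `√(q/6) ≤ s ≤ √(2q/3)`). census-1 (`StretchingLaminateCapClaim.lean`) and census-2
(`LaminateCapPolyT4.lean`) kernel-certified it for the T4 multipliers θ₀ = 269427/250000 (09:06Z). -/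
def PolyClaim (θ a b c₄ : ℝ) : Prop :=
  ∀ m q s : ℝ, 0 ≤ m → m ≤ 1 → 0 ≤ q → 0 ≤ s → q ≤ 6 * s ^ 2 → 3 * s ^ 2 ≤ 2 * q →
    (1 - 3 / 4 * b) * m * s - θ * q - a * (q - m / 2) - (3 * b / 2) * s * (2 * s ^ 2 - q)
      - c₄ * (q ^ 2 + (6 * q + 24) * (1 - m) - 24) ≤ 0

/-- One ordering: `d1` the largest eigenvalue. -/
theorem leafDV_case {θ a b c₄ : ℝ} (hb : 0 ≤ 1 - 3 / 4 * b) (h : PolyClaim θ a b c₄)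
    (d1 d2 d3 v1 v2 v3 : ℝ) (hs : d1 + d2 + d3 = 0) (h2 : d2 ≤ d1) (h3 : d3 ≤ d1)
    (hm : v1 ^ 2 + v2 ^ 2 + v3 ^ 2 ≤ 1) :
    (1 - 3 / 4 * b) * (d1 * v1 ^ 2 + d2 * v2 ^ 2 + d3 * v3 ^ 2) - θ * (d1 ^ 2 + d2 ^ 2 + d3 ^ 2)
      - a * ((d1 ^ 2 + d2 ^ 2 + d3 ^ 2) - (v1 ^ 2 + v2 ^ 2 + v3 ^ 2) / 2) - b * (d1 ^ 3 + d2 ^ 3 + d3 ^ 3)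
      - c₄ * ((d1 ^ 2 + d2 ^ 2 + d3 ^ 2) ^ 2 + (6 * (d1 ^ 2 + d2 ^ 2 + d3 ^ 2) + 24) * (1 - (v1 ^ 2 + v2 ^ 2 + v3 ^ 2))
        - 24) ≤ 0 := by
  have hd3 : d3 = -d1 - d2 := by linarith
  have hs0 : 0 ≤ d1 := by linarith
  have hq0 : 0 ≤ d1 ^ 2 + d2 ^ 2 + d3 ^ 2 := by positivity
  have hlo : d1 ^ 2 + d2 ^ 2 + d3 ^ 2 ≤ 6 * d1 ^ 2 := by
    rw [hd3]; nlinarith [mul_nonneg (sub_nonneg.2 h2) (by linarith : 0 ≤ 2 * d1 + d2)]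
  have hhi : 3 * d1 ^ 2 ≤ 2 * (d1 ^ 2 + d2 ^ 2 + d3 ^ 2) := by
    rw [hd3]; nlinarith [sq_nonneg (d1 + 2 * d2)]
  have hcube : d1 ^ 3 + d2 ^ 3 + d3 ^ 3 = 3 / 2 * d1 * (2 * d1 ^ 2 - (d1 ^ 2 + d2 ^ 2 + d3 ^ 2)) := by
    rw [hd3]; ring
  have hm0 : 0 ≤ v1 ^ 2 + v2 ^ 2 + v3 ^ 2 := by positivity
  have hp : d1 * v1 ^ 2 + d2 * v2 ^ 2 + d3 * v3 ^ 2 ≤ (v1 ^ 2 + v2 ^ 2 + v3 ^ 2) * d1 := by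
    nlinarith [mul_nonneg (sq_nonneg v2) (sub_nonneg.2 h2), mul_nonneg (sq_nonneg v3) (sub_nonneg.2 h3)]
  have key := h (v1 ^ 2 + v2 ^ 2 + v3 ^ 2) (d1 ^ 2 + d2 ^ 2 + d3 ^ 2) d1 hm0 hm hq0 hs0 hlo hhi
  rw [hcube]
  nlinarith [mul_le_mul_of_nonneg_left hp hb]

/-- **census form ⇒ eigenframe form** (for `1 − 3b/4 ≥ 0`): `ωᵀSω ≤ s₁|ω|²` termwise and `Σdᵢ³ = (3/2)s₁(2s₁² − q)`. -/
theorem leafDV_of_polyClaim {θ a b c₄ : ℝ} (hb : 0 ≤ 1 - 3 / 4 * b) (h : PolyClaim θ a b c₄) : LeafDV θ a b c₄ := by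
  intro d1 d2 d3 v1 v2 v3 hs hm
  rcases le_total d2 d1 with h21 | h12
  · rcases le_total d3 d1 with h31 | h13
    · exact leafDV_case hb h d1 d2 d3 v1 v2 v3 hs h21 h31 hm
    · -- d3 largest
      have := leafDV_case hb h d3 d1 d2 v3 v1 v2 (by linarith) h13 (by linarith) (by linarith)
      linarith
  · rcases le_total d3 d2 with h32 | h23
    · -- d2 largest
      have := leafDV_case hb h d2 d3 d1 v2 v3 v1 (by linarith) h32 h12 (by linarith)
      linarith
    · -- d3 largest
      have := leafDV_case hb h d3 d1 d2 v3 v1 v2 (by linarith) (by linarith) h23 (by linarith)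
      linarith

/-! ## Homogenisation (bank g5, verbatim) -/

/-- **Homogenised per-leaf dual inequality**, generic multipliers (`c₄ ≥ 0` for the `M = 0` case). -/
theorem leaf_hom_gen {θ a b c₄ : ℝ} (hc : 0 ≤ c₄) (hDV : LeafDV θ a b c₄)
    (d1 d2 d3 v1 v2 v3 M : ℝ) (hM : 0 ≤ M) (hs : d1 + d2 + d3 = 0) (hm : v1 ^ 2 + v2 ^ 2 + v3 ^ 2 ≤ M ^ 2) :
    (1 - 3 / 4 * b) * M * (d1 * v1 ^ 2 + d2 * v2 ^ 2 + d3 * v3 ^ 2) - θ * M ^ 2 * (d1 ^ 2 + d2 ^ 2 + d3 ^ 2)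
      - a * M ^ 2 * ((d1 ^ 2 + d2 ^ 2 + d3 ^ 2) - (v1 ^ 2 + v2 ^ 2 + v3 ^ 2) / 2) - b * M * (d1 ^ 3 + d2 ^ 3 + d3 ^ 3)
      - c₄ * ((d1 ^ 2 + d2 ^ 2 + d3 ^ 2) ^ 2 + (6 * (d1 ^ 2 + d2 ^ 2 + d3 ^ 2) + 24 * M ^ 2)
          * (M ^ 2 - (v1 ^ 2 + v2 ^ 2 + v3 ^ 2)) - 24 * M ^ 4) ≤ 0 := by
  rcases hM.eq_or_lt with h | h
  · subst h
    have hv : v1 ^ 2 + v2 ^ 2 + v3 ^ 2 = 0 := le_antisymm (by simpa using hm) (by positivity)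
    have hq := sq_nonneg (d1 ^ 2 + d2 ^ 2 + d3 ^ 2)
    rw [hv]
    nlinarith [mul_nonneg hc hq]
  · have hM' : M ≠ 0 := ne_of_gt h
    have key := hDV (d1 / M) (d2 / M) (d3 / M) (v1 / M) (v2 / M) (v3 / M)
      (by field_simp; linarith [hs])
      (by
        rw [div_pow, div_pow, div_pow, ← add_div, ← add_div, div_le_one (by positivity)]
        exact hm)
    have hM4 : 0 < M ^ 4 := by positivity
    have expand : (1 - 3 / 4 * b) * M * (d1 * v1 ^ 2 + d2 * v2 ^ 2 + d3 * v3 ^ 2) - θ * M ^ 2 * (d1 ^ 2 + d2 ^ 2 + d3 ^ 2)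
      - a * M ^ 2 * ((d1 ^ 2 + d2 ^ 2 + d3 ^ 2) - (v1 ^ 2 + v2 ^ 2 + v3 ^ 2) / 2) - b * M * (d1 ^ 3 + d2 ^ 3 + d3 ^ 3)
      - c₄ * ((d1 ^ 2 + d2 ^ 2 + d3 ^ 2) ^ 2 + (6 * (d1 ^ 2 + d2 ^ 2 + d3 ^ 2) + 24 * M ^ 2)
          * (M ^ 2 - (v1 ^ 2 + v2 ^ 2 + v3 ^ 2)) - 24 * M ^ 4)
      = M ^ 4 * ((1 - 3 / 4 * b) * (d1 / M * (v1 / M) ^ 2 + d2 / M * (v2 / M) ^ 2 + d3 / M * (v3 / M) ^ 2)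
        - θ * ((d1 / M) ^ 2 + (d2 / M) ^ 2 + (d3 / M) ^ 2)
        - a * (((d1 / M) ^ 2 + (d2 / M) ^ 2 + (d3 / M) ^ 2) - ((v1 / M) ^ 2 + (v2 / M) ^ 2 + (v3 / M) ^ 2) / 2)
        - b * ((d1 / M) ^ 3 + (d2 / M) ^ 3 + (d3 / M) ^ 3)
        - c₄ * ((((d1 / M) ^ 2 + (d2 / M) ^ 2 + (d3 / M) ^ 2)) ^ 2
          + (6 * ((d1 / M) ^ 2 + (d2 / M) ^ 2 + (d3 / M) ^ 2) + 24) * (1 - ((v1 / M) ^ 2 + (v2 / M) ^ 2 + (v3 / M) ^ 2))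
          - 24)) := by
      field_simp
    rw [expand]
    exact mul_nonpos_iff.2 (Or.inl ⟨hM4.le, key⟩)

/-! ## Part A' — eigenframe reduction of a real symmetric 3×3 matrix (Mathlib spectral theorem) -/

open Matrix in
/-- **Eigenframe reduction for a real symmetric `3 × 3` matrix**: there are `d v : Fin 3 → ℝ` (eigenvalues, and the
coordinates of `w` in an orthonormal eigenbasis) with `Σ dᵢ = tr S`, `Σ dᵢ² = |S|²`, `Σ dᵢ³ = tr S³`, `Σ vᵢ² = |w|²`,
`Σ dᵢ vᵢ² = wᵀ S w`.  (`Matrix.IsHermitian.spectral_theorem`.) -/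
theorem sym3_reduce (a b c x y z w0 w1 w2 : ℝ) :
    ∃ d v : Fin 3 → ℝ,
      d 0 + d 1 + d 2 = a + b + c ∧
      d 0 ^ 2 + d 1 ^ 2 + d 2 ^ 2 = a ^ 2 + b ^ 2 + c ^ 2 + 2 * (x ^ 2 + y ^ 2 + z ^ 2) ∧
      d 0 ^ 3 + d 1 ^ 3 + d 2 ^ 3
        = a ^ 3 + b ^ 3 + c ^ 3 + 3 * a * (x ^ 2 + y ^ 2) + 3 * b * (x ^ 2 + z ^ 2) + 3 * c * (y ^ 2 + z ^ 2)
          + 6 * x * y * z ∧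
      v 0 ^ 2 + v 1 ^ 2 + v 2 ^ 2 = w0 ^ 2 + w1 ^ 2 + w2 ^ 2 ∧
      d 0 * v 0 ^ 2 + d 1 * v 1 ^ 2 + d 2 * v 2 ^ 2
        = a * w0 ^ 2 + b * w1 ^ 2 + c * w2 ^ 2 + 2 * x * w0 * w1 + 2 * y * w0 * w2 + 2 * z * w1 * w2 := by
  let S : Matrix (Fin 3) (Fin 3) ℝ := !![a, x, y; x, b, z; y, z, c]
  let w : Fin 3 → ℝ := ![w0, w1, w2]
  have hS : S.IsHermitian := by
    apply Matrix.IsHermitian.ext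
    intro i j
    fin_cases i <;> fin_cases j <;> simp [S]
  set U : Matrix (Fin 3) (Fin 3) ℝ := (hS.eigenvectorUnitary : Matrix (Fin 3) (Fin 3) ℝ) with hU
  set d : Fin 3 → ℝ := hS.eigenvalues with hd
  set D : Matrix (Fin 3) (Fin 3) ℝ := diagonal d with hD
  have hU1 : star U * U = 1 := by rw [hU]; exact Unitary.coe_star_mul_self _
  have hU2 : U * star U = 1 := by rw [hU]; exact Unitary.coe_mul_star_self _
  have hSd : S = U * D * star U := by
    have h := hS.spectral_theorem
    rw [Unitary.conjStarAlgAut_apply] at h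
    have hcomp : (RCLike.ofReal ∘ hS.eigenvalues : Fin 3 → ℝ) = d := by
      funext i; simp [hd]
    rw [hcomp] at h
    exact h
  -- conjugation lemmas
  have conj_mul : ∀ X Y : Matrix (Fin 3) (Fin 3) ℝ, (U * X * star U) * (U * Y * star U) = U * (X * Y) * star U := by
    intro X Y
    calc (U * X * star U) * (U * Y * star U) = U * X * (star U * U) * Y * star U := by
          simp only [Matrix.mul_assoc]
      _ = U * (X * Y) * star U := by rw [hU1, Matrix.mul_one]; simp only [Matrix.mul_assoc]
  have conj_trace : ∀ X : Matrix (Fin 3) (Fin 3) ℝ, trace (U * X * star U) = trace X := by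
    intro X
    rw [Matrix.trace_mul_cycle, hU1, Matrix.one_mul]
  have hSS : S * S = U * (D * D) * star U := by rw [hSd, conj_mul]
  have hSSS : S * S * S = U * (D * D * D) * star U := by rw [hSS, hSd, conj_mul]
  -- traces of powers
  have t1 : trace S = d 0 + d 1 + d 2 := by
    have := hS.trace_eq_sum_eigenvalues
    simpa [Fin.sum_univ_three, hd] using this
  have t1' : trace S = a + b + c := by
    simp [S, Matrix.trace, Fin.sum_univ_three]
  have t2 : trace (S * S) = d 0 ^ 2 + d 1 ^ 2 + d 2 ^ 2 := by
    rw [hSS, conj_trace, hD, diagonal_mul_diagonal]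
    simp [Matrix.trace, Fin.sum_univ_three]
    ring
  have t2' : trace (S * S) = a ^ 2 + b ^ 2 + c ^ 2 + 2 * (x ^ 2 + y ^ 2 + z ^ 2) := by
    simp [S, Matrix.trace, Fin.sum_univ_three]
    ring
  have t3 : trace (S * S * S) = d 0 ^ 3 + d 1 ^ 3 + d 2 ^ 3 := by
    rw [hSSS, conj_trace, hD, diagonal_mul_diagonal, diagonal_mul_diagonal]
    simp [Matrix.trace, Fin.sum_univ_three]
    ring
  have t3' : trace (S * S * S)
      = a ^ 3 + b ^ 3 + c ^ 3 + 3 * a * (x ^ 2 + y ^ 2) + 3 * b * (x ^ 2 + z ^ 2) + 3 * c * (y ^ 2 + z ^ 2)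
          + 6 * x * y * z := by
    simp [S, Matrix.trace, Fin.sum_univ_three]
    ring
  -- the vector in the eigenframe
  set v : Fin 3 → ℝ := star U *ᵥ w with hv
  have hstarT : star U = Uᵀ := by
    rw [Matrix.star_eq_conjTranspose, Matrix.conjTranspose_eq_transpose_of_trivial]
  have hvw : v = w ᵥ* U := by rw [hv, hstarT, Matrix.mulVec_transpose]
  have n1x : (w ᵥ* U) ⬝ᵥ (star U *ᵥ w) = w ⬝ᵥ w := by
    rw [← Matrix.dotProduct_mulVec, Matrix.mulVec_mulVec, hU2, Matrix.one_mulVec]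
  have n1 : v ⬝ᵥ v = w ⬝ᵥ w := by
    have h := n1x
    rw [← hvw] at h
    simpa [← hv] using h
  have p1x : (w ᵥ* U) ⬝ᵥ (D *ᵥ (star U *ᵥ w)) = w ⬝ᵥ (S *ᵥ w) := by
    rw [← Matrix.dotProduct_mulVec, Matrix.mulVec_mulVec, Matrix.mulVec_mulVec, ← hSd]
  have p1 : v ⬝ᵥ (D *ᵥ v) = w ⬝ᵥ (S *ᵥ w) := by
    have h := p1x
    rw [← hvw] at h
    simpa [← hv] using h
  have n1' : v ⬝ᵥ v = v 0 ^ 2 + v 1 ^ 2 + v 2 ^ 2 := by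
    simp [dotProduct, Fin.sum_univ_three]; ring
  have n1'' : w ⬝ᵥ w = w0 ^ 2 + w1 ^ 2 + w2 ^ 2 := by
    simp [w, dotProduct, Fin.sum_univ_three]; ring
  have p1' : v ⬝ᵥ (D *ᵥ v) = d 0 * v 0 ^ 2 + d 1 * v 1 ^ 2 + d 2 * v 2 ^ 2 := by
    rw [hD]
    simp [dotProduct, Fin.sum_univ_three, mulVec_diagonal]; ring
  have p1'' : w ⬝ᵥ (S *ᵥ w)
      = a * w0 ^ 2 + b * w1 ^ 2 + c * w2 ^ 2 + 2 * x * w0 * w1 + 2 * y * w0 * w2 + 2 * z * w1 * w2 := by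
    simp [S, w, dotProduct, Matrix.mulVec, Fin.sum_univ_three]; ring
  refine ⟨d, v, ?_, ?_, ?_, ?_, ?_⟩
  · rw [← t1, t1']
  · rw [← t2, t2']
  · rw [← t3, t3']
  · rw [← n1', n1, n1'']
  · rw [← p1', p1, p1'']

/-! ## dict: the homogeneous eigenframe form and the bridge to the invariant node `LeafClaim` of (ap) -/

/-- **Homogeneous eigenframe form** of the per-leaf dual inequality (`M > 0`; `= leaf_hom_gen / M`). [ours; bookkeeping] -/
def FrameClaim (θ a b c : ℝ) : Prop :=
  ∀ d1 d2 d3 v1 v2 v3 M : ℝ, 0 < M → d1 + d2 + d3 = 0 → v1 ^ 2 + v2 ^ 2 + v3 ^ 2 ≤ M ^ 2 →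
    (1 - 3 / 4 * b) * (d1 * v1 ^ 2 + d2 * v2 ^ 2 + d3 * v3 ^ 2) ≤
      θ * M * (d1 ^ 2 + d2 ^ 2 + d3 ^ 2) + a * M * ((d1 ^ 2 + d2 ^ 2 + d3 ^ 2) - (v1 ^ 2 + v2 ^ 2 + v3 ^ 2) / 2)
        + b * (d1 ^ 3 + d2 ^ 3 + d3 ^ 3)
        + c / M * ((d1 ^ 2 + d2 ^ 2 + d3 ^ 2) ^ 2 + (6 * (d1 ^ 2 + d2 ^ 2 + d3 ^ 2) + 24 * M ^ 2)
            * (M ^ 2 - (v1 ^ 2 + v2 ^ 2 + v3 ^ 2)) - 24 * M ^ 4)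

/-- `LeafDV → FrameClaim` (divide bank's `leaf_hom_gen` by `M > 0`). [ours; elementary] -/
theorem frameClaim_of_leafDV {θ a b c : ℝ} (hc : 0 ≤ c) (h : LeafDV θ a b c) : FrameClaim θ a b c := by
  intro d1 d2 d3 v1 v2 v3 M hM hs hm
  have key := leaf_hom_gen hc h d1 d2 d3 v1 v2 v3 M hM.le hs hm
  have hM' : M ≠ 0 := hM.ne'
  have iden : θ * M * (d1 ^ 2 + d2 ^ 2 + d3 ^ 2) + a * M * ((d1 ^ 2 + d2 ^ 2 + d3 ^ 2) - (v1 ^ 2 + v2 ^ 2 + v3 ^ 2) / 2)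
        + b * (d1 ^ 3 + d2 ^ 3 + d3 ^ 3)
        + c / M * ((d1 ^ 2 + d2 ^ 2 + d3 ^ 2) ^ 2 + (6 * (d1 ^ 2 + d2 ^ 2 + d3 ^ 2) + 24 * M ^ 2)
            * (M ^ 2 - (v1 ^ 2 + v2 ^ 2 + v3 ^ 2)) - 24 * M ^ 4)
        - (1 - 3 / 4 * b) * (d1 * v1 ^ 2 + d2 * v2 ^ 2 + d3 * v3 ^ 2)
      = M⁻¹ * -((1 - 3 / 4 * b) * M * (d1 * v1 ^ 2 + d2 * v2 ^ 2 + d3 * v3 ^ 2) - θ * M ^ 2 * (d1 ^ 2 + d2 ^ 2 + d3 ^ 2)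
      - a * M ^ 2 * ((d1 ^ 2 + d2 ^ 2 + d3 ^ 2) - (v1 ^ 2 + v2 ^ 2 + v3 ^ 2) / 2) - b * M * (d1 ^ 3 + d2 ^ 3 + d3 ^ 3)
      - c * ((d1 ^ 2 + d2 ^ 2 + d3 ^ 2) ^ 2 + (6 * (d1 ^ 2 + d2 ^ 2 + d3 ^ 2) + 24 * M ^ 2)
          * (M ^ 2 - (v1 ^ 2 + v2 ^ 2 + v3 ^ 2)) - 24 * M ^ 4)) := by
    field_simp
    ring
  have hpos : 0 ≤ M⁻¹ * -((1 - 3 / 4 * b) * M * (d1 * v1 ^ 2 + d2 * v2 ^ 2 + d3 * v3 ^ 2) - θ * M ^ 2 * (d1 ^ 2 + d2 ^ 2 + d3 ^ 2)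
      - a * M ^ 2 * ((d1 ^ 2 + d2 ^ 2 + d3 ^ 2) - (v1 ^ 2 + v2 ^ 2 + v3 ^ 2) / 2) - b * M * (d1 ^ 3 + d2 ^ 3 + d3 ^ 3)
      - c * ((d1 ^ 2 + d2 ^ 2 + d3 ^ 2) ^ 2 + (6 * (d1 ^ 2 + d2 ^ 2 + d3 ^ 2) + 24 * M ^ 2)
          * (M ^ 2 - (v1 ^ 2 + v2 ^ 2 + v3 ^ 2)) - 24 * M ^ 4)) :=
    mul_nonneg (inv_nonneg.2 hM.le) (by linarith)
  linarith

/-- **The spectral bridge**: the eigenframe form implies the invariant node `LeafClaim` of (ap), by bank's `sym3_reduce`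
applied to `S = (G + Gᵀ)/2` and `ω = ω(G)`; the five invariants are identified with `Grad.trace`, `Grad.sSq`,
`Grad.symCubeTrace`, `Grad.vortSq`, `Grad.stretch` by `ring`. [ours; elementary] -/
theorem leafClaim_of_frameClaim {θ a b c : ℝ} (h : FrameClaim θ a b c) : LeafClaim θ a b c := by
  intro G M hM htr hvort
  obtain ⟨d, v, h1, h2, h3, h4, h5⟩ := sym3_reduce (G.g00 : ℝ) (G.g11 : ℝ) (G.g22 : ℝ)
      (((G.g01 : ℝ) + (G.g10 : ℝ)) / 2) (((G.g02 : ℝ) + (G.g20 : ℝ)) / 2) (((G.g12 : ℝ) + (G.g21 : ℝ)) / 2)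
      (G.vort0 : ℝ) (G.vort1 : ℝ) (G.vort2 : ℝ)
  have htr' : G.g00 + G.g11 + G.g22 = 0 := htr
  have D0 : d 0 + d 1 + d 2 = 0 := by
    rw [h1]; exact_mod_cast htr'
  have Q : ((G.sSq : ℚ) : ℝ) = d 0 ^ 2 + d 1 ^ 2 + d 2 ^ 2 := by
    rw [h2]; simp only [Grad.sSq]; push_cast; ring
  have C3 : ((G.symCubeTrace : ℚ) : ℝ) = d 0 ^ 3 + d 1 ^ 3 + d 2 ^ 3 := by
    rw [h3]; simp only [Grad.symCubeTrace]; push_cast; ring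
  have Vm : ((G.vortSq : ℚ) : ℝ) = v 0 ^ 2 + v 1 ^ 2 + v 2 ^ 2 := by
    rw [h4]; simp only [Grad.vortSq]; push_cast; ring
  have P : ((G.stretch : ℚ) : ℝ) = d 0 * v 0 ^ 2 + d 1 * v 1 ^ 2 + d 2 * v 2 ^ 2 := by
    rw [h5]; simp only [Grad.stretch]; push_cast; ring
  have hv : v 0 ^ 2 + v 1 ^ 2 + v 2 ^ 2 ≤ M ^ 2 := by rw [← Vm]; exact hvort
  rw [P, Q, C3, Vm]
  exact h (d 0) (d 1) (d 2) (v 0) (v 1) (v 2) M hM D0 hv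

/-- `PolyClaim → LeafClaim` (for `1 − 3b/4 ≥ 0`, `c ≥ 0`). [ours; elementary] -/
theorem leafClaim_of_polyClaim {θ a b c : ℝ} (hb : 0 ≤ 1 - 3 / 4 * b) (hc : 0 ≤ c) (h : PolyClaim θ a b c) :
    LeafClaim θ a b c :=
  leafClaim_of_frameClaim (frameClaim_of_leafDV hc (leafDV_of_polyClaim hb h))

/-- **`PolyClaim θ a b c → RatioBound θ`**: the complete dual pipeline of THEOREM L-CAP for generic multipliers
(census form of the leaf claim ⇒ eigenframe ⇒ invariant node ⇒ (ap) `ratioBound_of_leafClaim`: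
isometry (I1), laminate Betchov (I2), quartic moment (T4)). [ours; elementary] -/
theorem ratioBound_of_polyClaim {θ a b c : ℝ} (hb : 0 ≤ 1 - 3 / 4 * b) (hc : 0 ≤ c) (h : PolyClaim θ a b c) :
    RatioBound θ :=
  ratioBound_of_leafClaim (leafClaim_of_polyClaim hb hc h) hc

/-- `PolyClaim θ a b c → laminateSupConst ≤ θ`. [ours; elementary] -/
theorem laminateSupConst_le_of_polyClaim {θ a b c : ℝ} (hb : 0 ≤ 1 - 3 / 4 * b) (hc : 0 ≤ c)
    (h : PolyClaim θ a b c) : laminateSupConst ≤ θ :=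
  laminateSupConst_le_of_ratioBound (ratioBound_of_polyClaim hb hc h)

/-- `PolyClaim θ a b c` with `θ < 2/√3` gives the realization-free `LaminateDeficit` of (ae). [ours; elementary] -/
theorem laminateDeficit_of_polyClaim {θ a b c : ℝ} (hb : 0 ≤ 1 - 3 / 4 * b) (hc : 0 ≤ c)
    (h : PolyClaim θ a b c) (hθ : θ < 2 / Real.sqrt 3) : LaminateDeficit := by
  rw [laminateDeficit_iff]
  exact lt_of_le_of_lt (laminateSupConst_le_of_polyClaim hb hc h) hθ

/-- **The census claim discharges the node of (ap)**: `PolyClaim` at bank's T4 multipliers (literal rationals,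
= census-1's `lamcap_T4_claim_min` / census-2's `phiT4_nonpos` statement) implies `LCapLeafClaim`. [ours; elementary] -/
theorem lcapLeafClaim_of_polyClaim
    (h : PolyClaim (269427 / 250000) (-562019 / 1000000) (2007 / 15625) (55539 / 40000000)) : LCapLeafClaim := by
  have hb : (0 : ℝ) ≤ 1 - 3 / 4 * (2007 / 15625) := by norm_num
  have hc : (0 : ℝ) ≤ 55539 / 40000000 := by norm_num
  have hL := leafClaim_of_polyClaim hb hc h
  unfold LCapLeafClaim lcapTheta lcapA lcapB lcapC
  exact hL

end Laminate

end Summit.NavierStokesRegularity.FunctionalMining
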